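import Literature.NumberTheory.EllipticCurves.ZpExtensionEisensteinPiTorsionCutInputsProofs
import Literature.NumberTheory.EllipticCurves.ZpExtensionEisensteinH3UnramifiedProofs
import Literature.NumberTheory.GaloisCohomology.Howard2004.PiAdicRefinementCartesianProofs
import Literature.NumberTheory.GaloisCohomology.Howard2004.PropagateTowerProofs
import Literature.NumberTheory.GaloisCohomology.Howard2004.PropagateUnramifiedProofs
import Literature.NumberTheory.EllipticCurves.ZpExtensionEisensteinSelmerStructureProofs
import Literature.NumberTheory.EllipticCurves.ZpExtensionScalarTwistResidualQuotient
import HarnessLib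

/-!
# The residual image of Howard's `F_𝔮` at a place `w ∣ p` is the image of the TORSION CUT of `W₁ = T_𝔮/p`
# (ordinary places, anomalous or not; theorems only — no definition, no named fact, no instance, no `sorry`)

Topic `NumberTheory/EllipticCurves` (D1 road of cell `pub/bsd-print-x9`; brick (H5B-P-ANOM) of `Stmt.h5bAtS`, road «uniform
involution» (U) of seat `bsd-line-x9-p1-w3` g6, file F7a = the E-level readout).

B. Howard, *The Heegner point Kolyvagin system*, Compositio Math. 140 (2004), §1.3 H.5(b), Def. 3.1.2, §3.1, Lemma 3.2.7
(arXiv:1202.6340 p. 7 L96–97, p. 15 L99–108, p. 16): for the Eisenstein tower `T^{(j)} = E[p^j] ⊗ A_{m,j}(ψ)` over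
`S_𝔮 = Λ/(T^m + p)` and an ordinary datum `Fil_w` at a place `w ∋ p`, Howard's local condition `F_𝔮(w)` is the `p`-saturation
of the tower of strict ordinary conditions; its image `F̄_𝔮(w)` in `H¹(K_w, T̄)`, `T̄ = E[p]`, under a residual presentation
`π̄ : W₁ = T^{(1)} ↠ T̄` by `𝔪 = ([T])` is — WITHOUT any non-anomalous hypothesis, for `m ≥ 2p^s + c + c' + 1` —

  **`F̄_𝔮(w) = π̄_* { y ∈ H¹(K_w, W₁) : [T]^{2p^s} · y ∈ H¹_str(K_w, Fil_w W₁) }`**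

(`propagate_eisensteinSelmerStructure_eq_map_torsionCut`).  Here `κ(g₀) = p^s` for some `g₀ ∈ Γ_{K_w}` (the local image of
the character is open), `c`/`c'` are exponents with `π^c · H²(K_w, Fil_w(T/π^i)) = 0` and `π^{c'} · H²(K_w, T/π^i) = 0`
(hypotheses `hH2Fil`/`hH2` in the binder shapes of x10b-p1-w6's `piTorsionCut_hF2`/`piTorsionCut_hLift`; discharged by
x10b-p1-w5's (F4c) counts with `c = p^s`, `c' = 2p^s`).  In the non-anomalous case `s = 0` may fail but the cut with `r = 0`
is the strict condition itself, recovering `ZpExtensionEisensteinSelmerH5bOrdinaryPlacesProofs`.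

Assembly (no new mathematics): `eisensteinSelmerStructure_inr_of_mem` and the `π`-adic bridge
(`PiAdicRefinementCartesianProofs`: `map_projH_levelCondition_eq`, `map_mapH_levelCondition_eq`, `map_projH_ordinaryCore_eq`)
move `F_𝔮(w)` to the `π`-adic refinement `T/π^i`; F2 `Tower.map_levelCondition_eq_map_comap_strict` (this seat) reads the
saturated condition at `π`-level `N = m` (= `W₁`) as the torsion cut, its inputs being F3 (`ZpExtensionEisensteinPiOrdinaryFamiliesProofs`),
x10b-p1-w6's (F1b-INST) `piTorsionCut_hTor/_hF2/_hLift` and x10b-p1-w5's (F4a); finally `π̄` factors through the bijection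
`proj_m : W₁ → T/π^m` and `T/π → T̄` (`Howard2004.descend`), along which the cut is transported (`[T]^r = π^r` on `W₁`).
No summit statement is proved; BSD is not proved by any of this.

References: [Howard2004HeegnerKolyvagin] §1.3 H.5(b), Def. 1.1.3, §1.6, Def. 3.1.2, §3.1, Lemma 3.2.7; [GreenbergLNM1716] §2;
[MazurRubinMemoirs2004] Def. 1.1.1, Example 1.1.2; [SerreGaloisCohomology1997] I §2.2, II §5.2.
-/

set_option autoImplicit false

noncomputable section

open Function NumberField IsDedekindDomain Field
open scoped NumberField TensorProduct ContRepresentation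

namespace WeierstrassCurve

open Literature.NumberTheory.EllipticCurves Literature.NumberTheory.GaloisRepresentations
open Literature.NumberTheory.GaloisRepresentations.DiscreteGaloisModule
open Literature.NumberTheory.GaloisCohomology.Howard2004
open Literature.NumberTheory.EllipticCurves.IwasawaAlgebra Literature.NumberTheory.EllipticCurves.ZpExtension
open Literature.NumberTheory.EllipticCurves.Tower

/-! ## §0 Two pieces of subgroup plumbing -/

/-- `X.map F = (X.map G).map H` when `F = H ∘ G` pointwise. [folklore] -/
private theorem map_eq_map_map_of_forall {A B C : Type*} [AddCommGroup A] [AddCommGroup B] [AddCommGroup C]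
    (F : A →+ C) (G : A →+ B) (H : B →+ C) (h : ∀ a, F a = H (G a)) (X : AddSubgroup A) :
    X.map F = (X.map G).map H := by
  rw [AddSubgroup.map_map]
  exact congrArg (fun φ ↦ X.map φ) (AddMonoidHom.ext h)

/-- If a bijective additive map `Ψ` carries `S₁` onto `S₂` and `Ψ ∘ s₁ = s₂ ∘ Ψ`, then `Ψ` carries `s₁⁻¹ S₁` onto
`s₂⁻¹ S₂`. [folklore] -/
private theorem map_comap_eq_comap_of_bijective' {A B : Type*} [AddCommGroup A] [AddCommGroup B] (Ψ : A →+ B)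
    (hΨ : Function.Bijective Ψ) {S₁ : AddSubgroup A} {S₂ : AddSubgroup B} (hS : S₁.map Ψ = S₂) (s₁ : A →+ A)
    (s₂ : B →+ B) (hs : ∀ y, Ψ (s₁ y) = s₂ (Ψ y)) : (S₁.comap s₁).map Ψ = S₂.comap s₂ := by
  ext z
  constructor
  · rintro ⟨y, hy, rfl⟩
    rw [AddSubgroup.mem_comap, ← hs, ← hS]
    exact ⟨s₁ y, hy, rfl⟩
  · intro hz
    obtain ⟨y, rfl⟩ := hΨ.2 z
    refine ⟨y, ?_, rfl⟩
    rw [AddSubgroup.mem_comap, ← hs, ← hS] at hz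
    obtain ⟨y', hy', hyy⟩ := hz
    rw [AddSubgroup.coe_comap, Set.mem_preimage, SetLike.mem_coe, ← hΨ.1 hyy]
    exact hy'

/-! ## §1 The readout -/

variable {K : Type} [Field K] [NumberField K] (E : WeierstrassCurve K) [E.IsElliptic] {p : ℕ} [hp : Fact p.Prime]
  (κ : ZpExtension K p) {m : ℕ} (hm : 1 ≤ m) (S : Finset (HeightOneSpectrum (𝓞 K)))
  (Φ : ∀ v : HeightOneSpectrum (𝓞 K), ((p : ℕ) : 𝓞 K) ∈ v.asIdeal →
    OrdinaryFiltration (fun j ↦ E.torsionGaloisModule ((p : ℤ) ^ j)) (fun j ↦ E.torsionGaloisModuleReduce p j) v)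
  (w : HeightOneSpectrum (𝓞 K)) (hpw : ((p : ℕ) : 𝓞 K) ∈ w.asIdeal)
  [Module (EisensteinCoeff p m 1) (geomTorsion E (p : ℤ))]
  (πbar : EisensteinCoeff.Twisted p m 1 (geomTorsion E ((p : ℤ) ^ 1)) →ₗ[EisensteinCoeff p m 1] geomTorsion E (p : ℤ))
  (hbar : IsQuotientBy (κ.eisensteinTwist (E.torsionGaloisModule ((p : ℤ) ^ 1)) hm 1)
    (@IsLocalRing.maximalIdeal _ _ (EisensteinCoeff.isLocalRing_eisensteinCoeff p hm (le_refl 1)))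
    (E.torsionGaloisModule (p : ℤ)) πbar)

set_option maxHeartbeats 400000 in
/-- **`F̄_𝔮(w) = π̄_* (torsion cut of W₁)` at a place `w ∋ p`, anomalous or not.**  For the curve's Eisenstein tower with an
ordinary datum `Φ w` at `w` whose plus parts are onto under `×p` (`hFsurj`) and direct summands (`hbasis`), a residual
presentation `π̄ : W₁ ↠ T̄` by `([T])`, an element `g₀ ∈ Γ_{K_w}` with `κ(g₀) = p^s`, exponents `c`, `c'` killing the local
`H²` of the plus parts / of the levels of the `π`-adic refinement (`hH2Fil`/`hH2`, any endomorphism family `t` acting as `π^c`),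
and `2p^s + c + c' + 1 ≤ m`:
`(F_𝔮 propagated to T̄)(w) = π̄_* {y ∈ H¹(K_w, W₁) : [T]^{2p^s} y ∈ ker (H¹(K_w, W₁) → H¹(K_w, W₁ / Fil_w W₁))}`.
[cite: Howard2004HeegnerKolyvagin, §1.3 H.5(b), Def. 1.1.3, §1.6, Def. 3.1.2, §3.1 and Lemma 3.2.7 (arXiv:1202.6340 p. 7 L96–97, p. 5 L93–99, p. 12 L29–55, p. 15 L99–108, p. 16 L142–160)]
[cite: GreenbergLNM1716, §2] [cite: MazurRubinMemoirs2004, Def. 1.1.1 and Example 1.1.2] [cite: SerreGaloisCohomology1997, I §2.2 and II §5.2] -/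
theorem propagate_eisensteinSelmerStructure_eq_map_torsionCut
    (hFsurj : ∀ (k : ℕ) (y : geomTorsion E ((p : ℤ) ^ k)), y ∈ (Φ w hpw).fil k →
      ∃ y' ∈ (Φ w hpw).fil (k + 1), E.torsionGaloisModuleReduce p k y' = y)
    (hbasis : ∀ k, 1 ≤ k → ∃ e : geomTorsion E ((p : ℤ) ^ k) ≃+ (Fin 2 → ZMod (p ^ k)), ∀ x, x ∈ (Φ w hpw).fil k ↔ e x 1 = 0)
    {g₀ : absoluteGaloisGroup (w.adicCompletion K)} {s : ℕ}
    (hg₀ : (κ (absGaloisRestrict K (w.adicCompletion K) g₀)).toAdd = ((p ^ s : ℕ) : ℤ_[p])) (hms : 2 * p ^ s < m)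
    (t : ∀ j, ((GaloisRep.toLocal w ((E.eisensteinPiRefinementDatum κ hm).levelRep j)).subrepresentation
        (E.piFil κ hm (Φ w hpw) j) (E.piFil_le_comap κ hm (Φ w hpw) j)).toContRepresentation →ⁱL
      ((GaloisRep.toLocal w ((E.eisensteinPiRefinementDatum κ hm).levelRep j)).subrepresentation
        (E.piFil κ hm (Φ w hpw) j) (E.piFil_le_comap κ hm (Φ w hpw) j)).toContRepresentation)
    (c : ℕ)
    (ht : ∀ j (x : E.piFil κ hm (Φ w hpw) j),
      ((t j x : E.piFil κ hm (Φ w hpw) j) : (E.eisensteinPiRefinementDatum κ hm).Level j) =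
        (E.eisensteinPiRefinementDatum κ hm).π ^ c • (x : (E.eisensteinPiRefinementDatum κ hm).Level j))
    (hH2Fil : ∀ j (z : galoisCohomology ((GaloisRep.toLocal w
        ((E.eisensteinPiRefinementDatum κ hm).levelRep j)).subrepresentation
        (E.piFil κ hm (Φ w hpw) j) (E.piFil_le_comap κ hm (Φ w hpw) j)) 2), galoisCohomology.map (t j) 2 z = 0)
    {c' : ℕ}
    (hH2 : ∀ j (z : galoisCohomology (GaloisRep.toLocal w ((E.eisensteinPiRefinementDatum κ hm).levelRep j)) 2),
      galoisCohomology.scalarMap (GaloisRep.toLocal w ((E.eisensteinPiRefinementDatum κ hm).levelRep j))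
        (((E.eisensteinPiRefinementDatum κ hm).isScalarLinear_levelRep j).restrictField _) 2
        ((E.eisensteinPiRefinementDatum κ hm).π ^ c') z = 0)
    (hmN : 2 * p ^ s + c + c' + 1 ≤ m) :
    hbar.propagateStructure (κ.eisensteinSelmerStructure (fun j ↦ E.torsionGaloisModule ((p : ℤ) ^ j))
      (fun j ↦ E.torsionGaloisModuleReduce p j) hm S Φ 1) (Sum.inr w) =
      ((((κ.eisensteinTwist (E.torsionGaloisModule ((p : ℤ) ^ 1)) hm 1).toLocal (Sum.inr w)).strictSubgroup
          ((Φ w hpw).twistedFil (p := p) (m := m) 1) (fun g _ hx ↦ (Φ w hpw).twistedFil_le_comap hm 1 g hx)).comap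
        (galoisCohomology.scalarMapH1 _
          ((κ.isScalarLinear_eisensteinTwist (E.torsionGaloisModule ((p : ℤ) ^ 1)) hm 1).restrictField _)
          ((Ideal.Quotient.mk _ PowerSeries.X : EisensteinCoeff p m 1) ^ (2 * p ^ s)))).map
        (hbar.localCohomologyMap (Sum.inr w) 1) := by
  haveI := EisensteinCoeff.isLocalRing_eisensteinCoeff p hm (le_refl 1)
  set D := E.eisensteinPiRefinementDatum κ hm with hD
  -- ### the `π`-adic local presented family at `w` (letters of F2 / (F1b-INST))
  let ρG : ∀ j, DiscreteGaloisModule (w.adicCompletion K) (D.Level j) := fun j ↦ GaloisRep.toLocal w (D.levelRep j)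
  let fG : ∀ a b, (ρG a).toContRepresentation →ⁱL (ρG b).toContRepresentation := fun a b ↦
    localIntertwining (D.levelRep a) (D.levelRep b) w (D.map a b).toAddMonoidHom (D.map_equivariant_toLocal w a b)
  have hlinG : ∀ j, (ρG j).IsScalarLinear _ := fun j ↦ (D.isScalarLinear_levelRep j).restrictField (w.adicCompletion K)
  let FilG : ∀ j, Submodule ℤ (D.Level j) := fun j ↦ E.piFil κ hm (Φ w hpw) j
  have hΓG : ∀ j (σ : absoluteGaloisGroup (w.adicCompletion K)), FilG j ≤ (FilG j).comap (ρG j σ) :=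
    fun j σ ↦ E.piFil_le_comap κ hm (Φ w hpw) j σ
  have hmapF : ∀ a b, ∀ y ∈ FilG a, fG a b y ∈ FilG b := fun a b _ hy ↦ E.map_mem_piFil κ hm (Φ w hpw) hFsurj a b hy
  have hFilR : ∀ j (r : IwasawaAlgebra p ⧸
      Ideal.span {(PowerSeries.X ^ m + PowerSeries.C (p : ℤ_[p]) : IwasawaAlgebra p)}) (x : D.Level j),
      x ∈ FilG j → r • x ∈ FilG j := fun j r x hx ↦ E.smul_mem_piFil κ hm w (Φ w hpw) j r x hx
  obtain ⟨q, hq⟩ := Tower.exists_quotFamily_apply_mk ρG fG FilG hΓG hmapF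
  obtain ⟨πq, hπq⟩ := Tower.exists_quotPowFamily_apply_mk ρG hlinG D.π FilG hΓG hFilR
  haveI : ∀ j, Finite (galoisCohomology (ρG j) 1) := fun j ↦ E.finite_galoisCohomology_toLocal_piLevel κ hm w j
  haveI : ∀ j, Finite (galoisCohomology ((ρG j).quotient (FilG j) (hΓG j)) 1) :=
    fun j ↦ E.finite_galoisCohomology_toLocal_piLevel_quotient κ hm w (Φ w hpw) j
  -- ### F2 at the `π`-level `m * 1` (= `W₁`), read at `π`-level `1`
  have hN : 2 * p ^ s + c + c' + 1 ≤ m * 1 := by rw [Nat.mul_one]; exact hmN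
  have key : (levelCondition (H := fun j ↦ galoisCohomology (ρG j) 1) (fun j ↦ galoisCohomology.map (fG (j + 1) j) 1) p
        (fun j ↦ (ρG j).strictSubgroup (FilG j) (hΓG j)) (m * 1)).map (galoisCohomology.map (fG (m * 1) 1) 1) =
      (((ρG (m * 1)).strictSubgroup (FilG (m * 1)) (hΓG (m * 1))).comap
        (galoisCohomology.scalarMapH1 (ρG (m * 1)) (hlinG (m * 1)) (D.π ^ (2 * p ^ s)))).map
        (galoisCohomology.map (fG (m * 1) 1) 1) :=
    Tower.map_levelCondition_eq_map_comap_strict (ρ := ρG) (hlin := hlinG) (f := fG) (π := D.π) (Fil := FilG) (hΓ := hΓG)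
      hq hπq
      (fun a b r x ↦ (D.map a b).map_smul r x)
      (fun a x ↦ D.map_self a x)
      (fun _ _ _ hcb hba x ↦ D.map_map_of_le hcb hba x)
      (fun _ _ hab x ↦ D.map_map_succ hab x)
      (fun ℓ n ↦ D.map_surjective ℓ n)
      (fun ℓ n y ↦ D.map_eq_zero_iff ℓ n y)
      (fun ℓ n x ↦ D.map_map_smul ℓ n x)
      hmapF
      (fun ℓ n _ hy' ↦ E.exists_mem_piFil_map_eq κ hm (Φ w hpw) hFsurj ℓ n hy')
      (fun ℓ n y hy ↦ E.mem_piFil_of_map_mem κ hm (Φ w hpw) hFsurj hbasis ℓ n y hy)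
      p hms.le hN
      (fun j x ↦ E.pi_pow_smul_add_natCast_zsmul_eq_zero κ hm j x)
      (fun x ↦ by have h := D.pow_smul_level_eq_zero 1 x; rwa [pow_one] at h)
      (E.piTorsionCut_hTor κ hm w (Φ w hpw) hFsurj hbasis hg₀ hms hq hπq)
      (fun j w' ↦ E.piTorsionCut_hF2 κ hm w (Φ w hpw) hπq t c ht hH2Fil j w')
      (fun y ↦ E.piTorsionCut_hLift κ hm w (N := m * 1) (by omega) hH2 y)
  have key' : (levelCondition (fun a ↦ D.mapH w (a + 1) a) p (fun a ↦ E.piOrdinaryCore κ hm (Φ w hpw) a) (m * 1)).map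
        (D.mapH w (m * 1) 1) =
      ((E.piOrdinaryCore κ hm (Φ w hpw) (m * 1)).comap
        (galoisCohomology.scalarMapH1 (ρG (m * 1)) (hlinG (m * 1)) (D.π ^ (2 * p ^ s)))).map (D.mapH w (m * 1) 1) :=
    key
  -- ### hosts
  have h11 : D.host 1 ≤ 1 := by
    change (1 + m - 1) / m ≤ 1
    rw [Nat.add_sub_cancel_left, Nat.div_self hm]
  have hm1 : D.host (m * 1) ≤ 1 := E.eisensteinPiRefinementDatum_host_mul_le κ hm 1
  -- ### `π̄` factors through `proj₁ : W₁ → T/π` : the residual map `ē : T/π → T̄`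
  -- `π^n = [T]^n` on `W₁`
  have hsmulPow : ∀ (n : ℕ) (x : EisensteinLevel p m (fun j ↦ geomTorsion E ((p : ℤ) ^ j)) 1),
      D.π ^ n • x = ((Ideal.Quotient.mk _ PowerSeries.X : EisensteinCoeff p m 1) ^ n) • x := fun n x ↦ by
    change (Ideal.Quotient.mk (Ideal.span {(PowerSeries.X ^ m + PowerSeries.C (p : ℤ_[p]) : IwasawaAlgebra p)})
      PowerSeries.X) ^ n • x = _
    rw [← RingHom.map_pow (Ideal.Quotient.mk
        (Ideal.span {(PowerSeries.X ^ m + PowerSeries.C (p : ℤ_[p]) : IwasawaAlgebra p)})) PowerSeries.X n,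
      ZpExtension.EisensteinLevel.quotient_mk_smul_def,
      RingHom.map_pow (Ideal.Quotient.mk _ : IwasawaAlgebra p →+* EisensteinCoeff p m 1) PowerSeries.X n]
  have hker : LinearMap.ker (D.proj h11).toAddMonoidHom.toIntLinearMap ≤ LinearMap.ker πbar.toAddMonoidHom.toIntLinearMap := by
    intro x hx
    change πbar x = 0
    have hx' : x ∈ D.piPow 1 1 := by rw [← D.ker_proj h11]; exact hx
    obtain ⟨y, hy⟩ := (D.mem_piPow_iff 1 1 x).mp hx'
    have hXmem : (Ideal.Quotient.mk _ PowerSeries.X : EisensteinCoeff p m 1) ∈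
        IsLocalRing.maximalIdeal (EisensteinCoeff p m 1) := by
      rw [EisensteinCoeff.maximalIdeal_eisensteinCoeff_eq p hm (le_refl 1)]
      exact Ideal.mem_span_singleton_self _
    -- `y` viewed in `W₁ = Twisted` (the identity `equivTwisted`), where `ker π̄ = 𝔪 W₁`
    have hmem : ((Ideal.Quotient.mk _ PowerSeries.X : EisensteinCoeff p m 1) ^ 1 •
        ZpExtension.EisensteinLevel.equivTwisted 1 y) ∈ LinearMap.ker πbar := by
      rw [hbar.ker_eq]
      exact Submodule.smul_mem_smul (Ideal.pow_mem_of_mem _ hXmem 1 one_pos) Submodule.mem_top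
    rw [← hy, hsmulPow 1 y]
    exact LinearMap.mem_ker.mp hmem
  let ebar : D.Level 1 →ₗ[ℤ] geomTorsion E (p : ℤ) :=
    descend (D.proj h11).toAddMonoidHom.toIntLinearMap (D.proj_surjective h11) πbar.toAddMonoidHom.toIntLinearMap hker
  have hē : ∀ x, ebar (D.proj h11 x) = πbar x := fun x ↦
    descend_apply (D.proj h11).toAddMonoidHom.toIntLinearMap (D.proj_surjective h11) πbar.toAddMonoidHom.toIntLinearMap
      hker x
  have hēG : ∀ (g : absoluteGaloisGroup K) (y : D.Level 1),
      ebar (D.levelRep 1 g y) = E.torsionGaloisModule (p : ℤ) g (ebar y) := by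
    intro g y
    obtain ⟨x, rfl⟩ := D.proj_surjective h11 y
    rw [← (D.isQuotientBy_levelRep h11).equivariant g x, hē, hē]
    exact hbar.equivariant g x
  -- `H¹(ē)` and the factorisation `H¹(π̄) = H¹(ē) ∘ H¹(proj₁)`
  let Hē := ContinuousRep.cohomologyMap ((D.levelRep 1).toLocal (Sum.inr w)) ((E.torsionGaloisModule (p : ℤ)).toLocal (Sum.inr w))
    ebar.toAddMonoidHom continuous_of_discreteTopology (fun _ y ↦ hēG _ y) 1
  have hpH : ContinuousRep.cohomologyMap ((κ.eisensteinTwist (E.torsionGaloisModule ((p : ℤ) ^ 1)) hm 1).toLocal (Sum.inr w))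
      ((D.levelRep 1).toLocal (Sum.inr w)) (D.proj h11).toAddMonoidHom continuous_of_discreteTopology
      (fun _ x ↦ (D.isQuotientBy_levelRep h11).equivariant _ x) 1 = D.projH w h11 :=
    cohomologyMap_one_eq_map _ _ _ _ _
      (localIntertwining (D.ρ 1) (D.levelRep 1) w (D.proj h11).toAddMonoidHom (D.proj_equivariant_toLocal w h11))
      (fun _ ↦ rfl)
  have hfac : ∀ a, hbar.localCohomologyMap (Sum.inr w) 1 a = Hē (D.projH w h11 a) := fun a ↦
    (cohomologyMap_one_comp_apply ((κ.eisensteinTwist (E.torsionGaloisModule ((p : ℤ) ^ 1)) hm 1).toLocal (Sum.inr w))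
      ((D.levelRep 1).toLocal (Sum.inr w)) ((E.torsionGaloisModule (p : ℤ)).toLocal (Sum.inr w))
      (D.proj h11).toAddMonoidHom (fun _ x ↦ (D.isQuotientBy_levelRep h11).equivariant _ x)
      ebar.toAddMonoidHom (fun _ y ↦ hēG _ y) πbar.toAddMonoidHom (fun _ x ↦ hbar.equivariant _ x) hē a).symm.trans
      (congrArg (fun z ↦ Hē z) (DFunLike.congr_fun hpH a))
  -- ### `[T]^r = π^r` on `W₁`, and `H¹(proj_m)` intertwines the scalars
  have hTπ : galoisCohomology.scalarMapH1 (GaloisRep.toLocal w (D.ρ 1)) ((D.hlin 1).restrictField (w.adicCompletion K))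
      (D.π ^ (2 * p ^ s)) =
      galoisCohomology.scalarMapH1 _
        ((κ.isScalarLinear_eisensteinTwist (E.torsionGaloisModule ((p : ℤ) ^ 1)) hm 1).restrictField _)
        ((Ideal.Quotient.mk _ PowerSeries.X : EisensteinCoeff p m 1) ^ (2 * p ^ s)) :=
    galoisCohomology.scalarMapH1_eq_of_forall_smul_eq _ _ (fun x ↦ hsmulPow (2 * p ^ s) x)
  have hsc : ∀ y, D.projH w hm1 (galoisCohomology.scalarMapH1 _
        ((κ.isScalarLinear_eisensteinTwist (E.torsionGaloisModule ((p : ℤ) ^ 1)) hm 1).restrictField _)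
        ((Ideal.Quotient.mk _ PowerSeries.X : EisensteinCoeff p m 1) ^ (2 * p ^ s)) y) =
      galoisCohomology.scalarMapH1 (ρG (m * 1)) (hlinG (m * 1)) (D.π ^ (2 * p ^ s)) (D.projH w hm1 y) := fun y ↦ by
    have e1 : galoisCohomology.scalarMapH1 _
        ((κ.isScalarLinear_eisensteinTwist (E.torsionGaloisModule ((p : ℤ) ^ 1)) hm 1).restrictField _)
        ((Ideal.Quotient.mk _ PowerSeries.X : EisensteinCoeff p m 1) ^ (2 * p ^ s)) y =
        galoisCohomology.scalarMapH1 (GaloisRep.toLocal w (D.ρ 1)) ((D.hlin 1).restrictField (w.adicCompletion K))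
          (D.π ^ (2 * p ^ s)) y := DFunLike.congr_fun hTπ.symm y
    rw [e1]
    exact galoisCohomology.map_scalarMapH1 ((D.hlin 1).restrictField _) (hlinG (m * 1))
      (localIntertwining (D.ρ 1) (D.levelRep (m * 1)) w (D.proj hm1).toAddMonoidHom (D.proj_equivariant_toLocal w hm1))
      (fun r x ↦ (D.proj hm1).map_smul r x) _ y
  -- ### assembly
  have hred : (κ.eisensteinLocalReduce (fun j ↦ E.torsionGaloisModule ((p : ℤ) ^ j))
      (fun j ↦ E.torsionGaloisModuleReduce p j) hm (Sum.inr w)) = fun j ↦ D.redH w (Nat.le_succ j) :=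
    funext fun j ↦ (E.redH_eisensteinPiRefinementDatum_eq_eisensteinLocalReduce κ hm w j).symm
  rw [IsQuotientBy.propagateStructure_apply, κ.eisensteinSelmerStructure_inr_of_mem _ _ hm S Φ 1 hpw, hred,
    map_eq_map_map_of_forall (hbar.localCohomologyMap (Sum.inr w) 1) (D.projH w h11) Hē hfac,
    map_eq_map_map_of_forall (hbar.localCohomologyMap (Sum.inr w) 1) (D.projH w h11) Hē hfac]
  refine congrArg (fun X ↦ AddSubgroup.map Hē X) ?_
  -- `(L^H_1).map H¹(proj₁) = L^G_1 = (L^G_m).map H¹(map m 1) = (cut^G_m).map H¹(map m 1) = (cut_{W₁}).map H¹(proj₁)`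
  have hL := D.map_projH_levelCondition_eq w p (fun j ↦ E.eisensteinPiRefinementDatum_host_mul_le κ hm j)
    (fun j ↦ (Φ w hpw).ordinaryCore hm j) (fun a ↦ E.piOrdinaryCore κ hm (Φ w hpw) a) hm (fun j ↦ rfl)
    (fun a b hba y hy ↦ E.mapH_mem_piOrdinaryCore κ hm (Φ w hpw) hba hy)
    (fun j ↦ E.map_projH_ordinaryCore_eq κ hm (Φ w hpw) j) (k := 1) (i := 1) (by omega) h11
  have hLG := (D.map_mapH_levelCondition_eq w p (fun a ↦ E.piOrdinaryCore κ hm (Φ w hpw) a) (i := 1) (t := m * 1)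
    (by omega)).symm
  have hg := map_comap_eq_comap_of_bijective' (D.projH w hm1) (D.projH_bijective w hm1 (E.eisensteinPiRefinementDatum_e κ hm 1))
    (E.map_projH_ordinaryCore_eq κ hm (Φ w hpw) 1) _ _ hsc
  have hcut := congrArg (fun X ↦ AddSubgroup.map (D.mapH w (m * 1) 1) X) hg
  refine (hL.trans (hLG.trans (key'.trans hcut.symm))).trans ?_
  exact (map_eq_map_map_of_forall (D.projH w h11) (D.projH w hm1) (D.mapH w (m * 1) 1)
    (fun y ↦ (D.mapH_projH w (show 1 ≤ m * 1 by omega) h11 hm1 y).symm) _).symm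

end WeierstrassCurve

end
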